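import Literature.Probability.LatticeModels.MarkovWindowDensity
import HarnessLib

/-!
# Iterates of a transfer operator as marginal integrals over a block of consecutive sites

Topic `Literature/Probability/LatticeModels`; theorems only (no definitions, no named facts).
Companion of `MarkovWindowDensity.lean` (window densities of the two-sided stationary Markov chain
of a transfer kernel). This file PROVES the elementary identity behind every transfer-operator
computation for one-dimensional nearest-neighbour models (Georgii 2011, Ch. 10–11; Baxter 1982,
Ch. 2; for unbounded-spin chains Cassandro–Olivieri–Pellegrinotti–Presutti 1978, §2): integrating
the un-normalised nearest-neighbour Boltzmann weight of a block of `m` consecutive sites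
`a, …, a+m-1` — site weights `w(σ_y)` and bond factors `k(σ_{y-1}, σ_y)`, `y = a, …, a+m-1`, the
first bond coupling the block to the boundary spin `σ_{a-1}` — against an observable `h(σ_{a+m-1})`
attached to the last site gives the `m`-th ITERATE of the transfer map
`(T f)(z) = ∫ k(z, y) w(y) f(y) dν(y)` evaluated at the boundary spin:

  `∫⋯∫⁻_{a ≤ y < a+m} [∏_y w(σ_y) k(σ_{y-1}, σ_y)] h(σ_{a+m-1}) G(σ) = (T^[m] h)(σ_{a-1}) · G(σ)`

for every `G` not reading the block (Mathlib marginal integrals `MeasureTheory.lmarginal` on the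
configuration space `ℤ → S`). To avoid a definition, the transfer map is a VARIABLE `Tr` constrained
by the hypothesis `hTr : ∀ f z, Tr f z = ∫⁻ y, k z y * w y * f y ∂ν`.

* `measurable_transfer_apply`, `measurable_iterate_transfer` — measurability bookkeeping;
* `lmarginal_Ico_blockWeight_eq_iterate_transfer` — the identity above (induction on `m`, peeling
  the first site with `lmarginal_insert`).

[cite: Georgii2011, Thm 10.25 and §11.1]
-/

noncomputable section

open MeasureTheory Set Function Finset
open scoped ENNReal

namespace Literature.Probability.LatticeModels

variable {S : Type*} [MeasurableSpace S] {ν : Measure S}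
variable {k : S → S → ℝ≥0∞} {w : S → ℝ≥0∞}

/-- The transfer map `z ↦ ∫ k(z,y) w(y) f(y) dν(y)` of a measurable `f` is measurable.
[cite: Georgii2011, Thm 10.25 and §11.1] -/
theorem measurable_transfer_apply [SFinite ν] (hk : Measurable (uncurry k)) (hw : Measurable w)
    {f : S → ℝ≥0∞} (hf : Measurable f) :
    Measurable fun z => ∫⁻ y, k z y * w y * f y ∂ν := by
  have h : Measurable fun p : S × S => k p.1 p.2 * w p.2 * f p.2 :=
    (hk.mul (hw.comp measurable_snd)).mul (hf.comp measurable_snd)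
  exact h.lintegral_prod_right'

/-- Every iterate `T^[m] f` of the transfer map applied to a measurable `f` is measurable.
[cite: Georgii2011, Thm 10.25 and §11.1] -/
theorem measurable_iterate_transfer [SFinite ν] (hk : Measurable (uncurry k)) (hw : Measurable w)
    {Tr : (S → ℝ≥0∞) → (S → ℝ≥0∞)} (hTr : ∀ f z, Tr f z = ∫⁻ y, k z y * w y * f y ∂ν)
    {f : S → ℝ≥0∞} (hf : Measurable f) (m : ℕ) : Measurable (Tr^[m] f) := by
  induction m with
  | zero => simpa using hf
  | succ m ih =>
    rw [Function.iterate_succ_apply']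
    have hfun : Tr (Tr^[m] f) = fun z => ∫⁻ y, k z y * w y * (Tr^[m] f) y ∂ν := funext (hTr _)
    rw [hfun]
    exact measurable_transfer_apply hk hw ih

/-- **Transfer-operator iterates are block marginal integrals.** For measurable `k`, `w`, `h`,
every `m : ℕ`, every left end `a : ℤ`, every measurable `G` not reading the sites
`a, …, a+m-1`, and every configuration `η`:
`(∫⋯∫⁻_{Ico a (a+m)} [∏_{a ≤ y < a+m} w(σ_y) k(σ_{y-1}, σ_y)] · h(σ_{a+m-1}) · G(σ))(η)
  = (T^[m] h)(η_{a-1}) · G(η)`,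
`(T f)(z) = ∫ k(z,y) w(y) f(y) dν(y)` (for `m = 0` both sides are `h(η_{a-1}) G(η)`). This is the
path-integral / Markov "peeling" identity of one-dimensional nearest-neighbour models
(Georgii 2011, proof of Thm 10.25; Baxter 1982, §2.1). [cite: Georgii2011, Thm 10.25 and §11.1] -/
theorem lmarginal_Ico_blockWeight_eq_iterate_transfer [SigmaFinite ν]
    (hk : Measurable (uncurry k)) (hw : Measurable w)
    {Tr : (S → ℝ≥0∞) → (S → ℝ≥0∞)} (hTr : ∀ f z, Tr f z = ∫⁻ y, k z y * w y * f y ∂ν)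
    {h : S → ℝ≥0∞} (hh : Measurable h) (m : ℕ) :
    ∀ (a : ℤ) {G : (ℤ → S) → ℝ≥0∞}, Measurable G →
      DependsOn G ((↑(Finset.Ico a (a + m)) : Set ℤ)ᶜ) → ∀ η : ℤ → S,
        (∫⋯∫⁻_Finset.Ico a (a + m),
            (fun σ => (∏ y ∈ Finset.Ico a (a + m), (w (σ y) * k (σ (y - 1)) (σ y))) *
              h (σ (a + m - 1)) * G σ) ∂fun _ : ℤ => ν) η =
          (Tr^[m] h) (η (a - 1)) * G η := by
  induction m with
  | zero =>
    intro a G _ _ η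
    simp
  | succ m ih =>
    intro a G hG hGd η
    -- the block `a, …, a+m` is the site `a` followed by the block `a+1, …, a+m`
    have hIco : Finset.Ico a (a + ((m + 1 : ℕ) : ℤ)) = insert a (Finset.Ico (a + 1) (a + 1 + m)) := by
      ext x
      simp only [Finset.mem_Ico, Finset.mem_insert]
      push_cast
      omega
    have hnot : a ∉ Finset.Ico (a + 1) (a + 1 + m) := by simp
    -- measurability of the pieces
    have hWy : ∀ y : ℤ, Measurable fun σ : ℤ → S => w (σ y) * k (σ (y - 1)) (σ y) := fun y =>
      (measurable_comp_eval hw y).mul (measurable_kernel_eval hk (y - 1) y)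
    have hrest : Measurable fun σ : ℤ → S =>
        (∏ y ∈ Finset.Ico (a + 1) (a + 1 + m), (w (σ y) * k (σ (y - 1)) (σ y))) *
          h (σ (a + 1 + m - 1)) * G σ :=
      ((Finset.measurable_prod _ fun y _ => hWy y).mul (hh.comp (measurable_pi_apply _))).mul hG
    -- rewrite the integrand as (weight of site `a`) * (integrand of the smaller block)
    have hfun : (fun σ : ℤ → S => (∏ y ∈ Finset.Ico a (a + ((m + 1 : ℕ) : ℤ)),
        (w (σ y) * k (σ (y - 1)) (σ y))) * h (σ (a + ((m + 1 : ℕ) : ℤ) - 1)) * G σ) =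
        fun σ => (w (σ a) * k (σ (a - 1)) (σ a)) *
          ((∏ y ∈ Finset.Ico (a + 1) (a + 1 + m), (w (σ y) * k (σ (y - 1)) (σ y))) *
            h (σ (a + 1 + m - 1)) * G σ) := by
      funext σ
      have h1 : a + ((m + 1 : ℕ) : ℤ) - 1 = a + 1 + (m : ℤ) - 1 := by push_cast; ring
      rw [hIco, Finset.prod_insert hnot, h1]
      ring
    have hdepa : DependsOn (fun σ : ℤ → S => w (σ a) * k (σ (a - 1)) (σ a))
        (↑({a - 1, a} : Finset ℤ) : Set ℤ) := by
      intro σ σ' hσ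
      have h1 : σ a = σ' a := hσ a (by simp)
      have h2 : σ (a - 1) = σ' (a - 1) := hσ (a - 1) (by simp)
      simp only [h1, h2]
    have hdisj : Disjoint (Finset.Ico (a + 1) (a + 1 + m)) ({a - 1, a} : Finset ℤ) := by
      rw [Finset.disjoint_left]
      intro x hx hx'
      simp only [Finset.mem_Ico] at hx
      simp only [Finset.mem_insert, Finset.mem_singleton] at hx'
      omega
    have hsub : ((↑(Finset.Ico (a + 1) (a + 1 + (m : ℤ))) : Set ℤ) ⊆
        ↑(Finset.Ico a (a + ((m + 1 : ℕ) : ℤ)))) := by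
      rw [hIco]
      exact Finset.coe_subset.2 (Finset.subset_insert _ _)
    have hGd' : DependsOn G ((↑(Finset.Ico (a + 1) (a + 1 + (m : ℤ))) : Set ℤ)ᶜ) :=
      DependsOn.mono (Set.compl_subset_compl.2 hsub) hGd
    have hmeasf : Measurable fun σ : ℤ → S => (w (σ a) * k (σ (a - 1)) (σ a)) *
        ((∏ y ∈ Finset.Ico (a + 1) (a + 1 + m), (w (σ y) * k (σ (y - 1)) (σ y))) *
          h (σ (a + 1 + m - 1)) * G σ) := (hWy a).mul hrest
    rw [hfun, hIco, lmarginal_insert _ hmeasf hnot]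
    -- the inner marginal: pull out the weight of site `a` and use the induction hypothesis
    have hinner : ∀ z : S,
        (∫⋯∫⁻_Finset.Ico (a + 1) (a + 1 + m), (fun σ : ℤ → S => (w (σ a) * k (σ (a - 1)) (σ a)) *
          ((∏ y ∈ Finset.Ico (a + 1) (a + 1 + m), (w (σ y) * k (σ (y - 1)) (σ y))) *
            h (σ (a + 1 + m - 1)) * G σ)) ∂fun _ : ℤ => ν) (Function.update η a z) =
          (k (η (a - 1)) z * w z * (Tr^[m] h) z) * G η := by
      intro z
      rw [lmarginal_mul_left_of_dependsOn' hdepa hdisj hrest, ih (a + 1) hG hGd']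
      have hz : Function.update η a z a = z := Function.update_self _ _ _
      have hz' : Function.update η a z (a - 1) = η (a - 1) :=
        Function.update_of_ne (by omega) _ _
      have hz'' : Function.update η a z (a + 1 - 1) = z := by
        rw [show a + 1 - 1 = a by ring]; exact hz
      have hGz : G (Function.update η a z) = G η :=
        hGd fun i hi => Function.update_of_ne (by
          intro hia
          apply hi
          subst hia
          simp) _ _
      rw [hz, hz', hz'', hGz]
      ring
    simp_rw [hinner]
    have hmeas : Measurable fun z => k (η (a - 1)) z * w z * (Tr^[m] h) z :=
      ((hk.comp (measurable_const.prodMk measurable_id)).mul hw).mul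
        (measurable_iterate_transfer hk hw hTr hh m)
    rw [lintegral_mul_const _ hmeas, Function.iterate_succ_apply', hTr]

end Literature.Probability.LatticeModels

end
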